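import Mathlib
import Summits.PneNP.PneNP.Theorems.SfmBlMatrixToolkit

/-!
# The bipartite signed form as a symmetric quadratic form — line «sfm-bl» (PROOF-SFM-BL Lemma 2(b))

FRONTIER F-N1c; nothing here bears on P vs NP.

The cut-norm certificate is a bilinear form `σᵀ M φ` of a rectangular real matrix `M` (signed piece-level
biadjacency).  The trace toolkit (`SfmBlMatrixToolkit`) speaks about symmetric square matrices.  The bridge
is the usual bipartite double: `A = [[0, M], [Mᵀ, 0]]` on `α ⊕ β` and `z = (σ, φ)`, for which
`zᵀAz = 2·σᵀMφ` and `‖z‖² = ‖σ‖² + ‖φ‖²`.  Consequently (`bilinForm_pow_le_trace`)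
`(2σᵀMφ)^L ≤ (‖σ‖²+‖φ‖²)^L · tr(A^L)` for `L = 2^{j+2}` — the eigenvalue-free form of
"`σᵀMφ ≤ ½ λ_max(A)·(|α|+|β|)` for ±1 vectors".
-/

namespace Summit.PneNP.PneNP.Theorems.SfmBl

open Matrix Finset BigOperators

variable {α β : Type} [Fintype α] [Fintype β]

omit [Fintype α] [Fintype β] in
/-- The bipartite double `[[0, M], [Mᵀ, 0]]` of a rectangular matrix is symmetric. -/
theorem fromBlocks_bipartite_isSymm (M : Matrix α β ℝ) :
    (Matrix.fromBlocks (0 : Matrix α α ℝ) M Mᵀ (0 : Matrix β β ℝ)).IsSymm := by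
  rw [Matrix.isSymm_fromBlocks_iff]
  exact ⟨Matrix.isSymm_zero, rfl, Matrix.transpose_transpose M, Matrix.isSymm_zero⟩

/-- `zᵀAz = 2·σᵀMφ` for the bipartite double and `z = (σ, φ)`. -/
theorem bipartite_quadForm (M : Matrix α β ℝ) (σ : α → ℝ) (φ : β → ℝ) :
    Sum.elim σ φ ⬝ᵥ ((Matrix.fromBlocks (0 : Matrix α α ℝ) M Mᵀ (0 : Matrix β β ℝ)) *ᵥ Sum.elim σ φ)
      = 2 * (σ ⬝ᵥ (M *ᵥ φ)) := by
  rw [Matrix.fromBlocks_mulVec]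
  simp only [Sum.elim_comp_inl, Sum.elim_comp_inr, Matrix.zero_mulVec, zero_add, add_zero,
    sumElim_dotProduct_sumElim]
  rw [Matrix.mulVec_transpose, dotProduct_comm φ, ← Matrix.dotProduct_mulVec]
  ring

/-- `‖(σ, φ)‖² = ‖σ‖² + ‖φ‖²`. -/
theorem sum_elim_normSq (σ : α → ℝ) (φ : β → ℝ) :
    Sum.elim σ φ ⬝ᵥ Sum.elim σ φ = σ ⬝ᵥ σ + φ ⬝ᵥ φ := by
  simp [sumElim_dotProduct_sumElim]

/-- LEMMA 2(b), eigenvalue-free: for every rectangular real `M`, all vectors `σ, φ` and every `L = 2^{j+2}`,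
`(2·σᵀMφ)^L ≤ (‖σ‖² + ‖φ‖²)^L · tr(A^L)` where `A` is the bipartite double of `M`.  For ±1 vectors
`‖σ‖² + ‖φ‖² = |α| + |β|`, so `|σᵀMφ| ≤ ½(|α|+|β|)·tr(A^L)^{1/L}`. -/
theorem bilinForm_pow_le_trace [DecidableEq α] [DecidableEq β] (M : Matrix α β ℝ) (σ : α → ℝ)
    (φ : β → ℝ) (j : ℕ) :
    (2 * (σ ⬝ᵥ (M *ᵥ φ))) ^ (2 ^ (j + 2))
      ≤ (σ ⬝ᵥ σ + φ ⬝ᵥ φ) ^ (2 ^ (j + 2))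
        * ((Matrix.fromBlocks (0 : Matrix α α ℝ) M Mᵀ (0 : Matrix β β ℝ)) ^ (2 ^ (j + 2))).trace := by
  have h := quadForm_pow_le_trace (Matrix.fromBlocks (0 : Matrix α α ℝ) M Mᵀ (0 : Matrix β β ℝ))
    (fromBlocks_bipartite_isSymm M) (Sum.elim σ φ) j
  rwa [bipartite_quadForm, sum_elim_normSq] at h

/-- For ±1-valued `σ, φ`: `‖σ‖² + ‖φ‖² = |α| + |β|`. -/
theorem pm_one_normSq (σ : α → ℝ) (φ : β → ℝ) (hσ : ∀ i, σ i = 1 ∨ σ i = -1)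
    (hφ : ∀ k, φ k = 1 ∨ φ k = -1) :
    σ ⬝ᵥ σ + φ ⬝ᵥ φ = Fintype.card α + Fintype.card β := by
  have h1 : σ ⬝ᵥ σ = Fintype.card α := by
    have : ∀ i, σ i * σ i = 1 := fun i => by rcases hσ i with h | h <;> simp [h]
    simp only [dotProduct, this, Finset.sum_const, Finset.card_univ, nsmul_eq_mul, mul_one]
  have h2 : φ ⬝ᵥ φ = Fintype.card β := by
    have : ∀ k, φ k * φ k = 1 := fun k => by rcases hφ k with h | h <;> simp [h]
    simp only [dotProduct, this, Finset.sum_const, Finset.card_univ, nsmul_eq_mul, mul_one]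
  rw [h1, h2]

end Summit.PneNP.PneNP.Theorems.SfmBl
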